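import Literature.MathematicalPhysics.StatisticalMechanics.BarlowStackingEnergy

/-!
# `PeriodicGivenLayered` (stmt-AtomisticToContinuum-11779), line `Sketch`, helper for stub `stub_layerCake`:
# geometry of exactly layered sets

Support file for the crux `PhononSlackCertificates.PeriodicGivenLayered` (= `HullMinimality.PeriodicGivenLayered`).
The layered sets of the line are `S(A, s, z) = {A (i • u(a) + j • v(a) + L(m) • w(a) + z(m) • e₃)}` with `L = haggLabel s`
and free heights `z`. This file is coordinate bookkeeping only:

* every such point is `A (layerVec a (z m) (L m) 1 i j)` (`cake_pt_eq_layerVec`), differences of two of them are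
  `layerVec a (z m' - z m) (L m' - L m) 1 (i' - i) (j' - j)` (`cake_layerVec_sub`), and the laterally re-centred
  parametrisation of the prisms is `layerVec a (z m) (L m % 3) 1 x y` (`cake_recentre`);
* coordinate lower bounds for `‖layerVec a H δ 1 p q‖` (vertical `|H|`, the two in-plane coordinates, and the
  in-layer bound `≥ a` off the origin);
* heights with increments in `[39a/50, 17a/20]` are strictly increasing with `|z m' - z m| ≥ (39a/50) |m' - m|`;
* injectivity of `(m, i, j) ↦ layerVec a (z m) (L m) 1 i j` and the `1/2`-separation of `S(A, s, z)`.
-/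

namespace Summit.AtomisticToContinuum.Crystallization.Theorems.LayeredHull

open Literature.MathematicalPhysics.StatisticalMechanics

local notation "E3" => EuclideanSpace ℝ (Fin 3)

/-! ## Layered points as `layerVec`s -/

/-- `h • e₃ = layerNormal h`. [folklore] -/
theorem cake_smul_layerNormal_one (h : ℝ) : h • layerNormal 1 = layerNormal h := by
  ext i
  fin_cases i <;> simp [layerNormal]

/-- A layered point `i u + j v + L w + h e₃` is `layerVec a h L 1 i j`. [folklore] -/
theorem cake_pt_eq_layerVec (a h : ℝ) (L i j : ℤ) :
    ((i : ℝ) • triangularVec₁ a) + ((j : ℝ) • triangularVec₂ a) + ((L : ℝ) • barlowOffset a) +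
      (h • layerNormal 1) = layerVec a h L 1 i j := by
  rw [layerVec, cake_smul_layerNormal_one]
  simp

/-- Differences of layered points. [folklore] -/
theorem cake_layerVec_sub (a h h' : ℝ) (L L' i j i' j' : ℤ) :
    layerVec a h' L' 1 i' j' - layerVec a h L 1 i j = layerVec a (h' - h) (L' - L) 1 (i' - i) (j' - j) := by
  ext l
  fin_cases l <;> simp <;> ring

/-- The height coordinate of `layerVec a h L 1 i j` is `h`. [folklore] -/
theorem cake_layerVec_apply_two (a h : ℝ) (L i j : ℤ) : layerVec a h L 1 i j 2 = h := by
  simp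

/-- Lateral re-centring: with `q = L / 3` (integer division), `(x - q) u + (y - q) v + L w + h e₃` is the point
`x u + y v + (L % 3) w + h e₃` (`3 w = u + v`). [folklore] -/
theorem cake_recentre (a h : ℝ) (L x y : ℤ) :
    (((x - L / 3 : ℤ) : ℝ) • triangularVec₁ a) + (((y - L / 3 : ℤ) : ℝ) • triangularVec₂ a) +
      ((L : ℝ) • barlowOffset a) + (h • layerNormal 1) = layerVec a h (L % 3) 1 x y := by
  set q : ℝ := ((L / 3 : ℤ) : ℝ) with hq
  set r : ℝ := ((L % 3 : ℤ) : ℝ) with hr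
  have hL : (L : ℝ) = r + 3 * q := by
    have h' : ((L % 3 : ℤ) : ℝ) + 3 * ((L / 3 : ℤ) : ℝ) = L := by exact_mod_cast Int.emod_add_mul_ediv L 3
    rw [hr, hq]
    linarith
  have h3 := three_smul_barlowOffset a
  rw [← cake_pt_eq_layerVec, ← hr]
  push_cast
  rw [← hq, hL, add_smul, show (3 : ℝ) * q = q * 3 by ring, mul_smul, h3]
  module

/-! ## Coordinate bounds -/

/-- The vertical coordinate bounds the norm: `|H| ≤ ‖layerVec a H δ 1 p q‖`. [folklore] -/
theorem cake_abs_height_le_norm (a H : ℝ) (δ p q : ℤ) : |H| ≤ ‖layerVec a H δ 1 p q‖ := by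
  have h := PiLp.norm_apply_le (layerVec a H δ 1 p q) 2
  rwa [cake_layerVec_apply_two, Real.norm_eq_abs] at h

/-- The first in-plane coordinate bounds the norm. [folklore] -/
theorem cake_abs_fst_le_norm (a H : ℝ) (δ p q : ℤ) :
    |a * (p + q / 2 + δ / 2)| ≤ ‖layerVec a H δ 1 p q‖ := by
  have h := PiLp.norm_apply_le (layerVec a H δ 1 p q) 0
  rwa [layerVec_apply_zero, Real.norm_eq_abs] at h

/-- The second in-plane coordinate bounds the norm. [folklore] -/
theorem cake_abs_snd_le_norm (a H : ℝ) (δ p q : ℤ) :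
    |a * √3 / 2 * (q + δ / 3)| ≤ ‖layerVec a H δ 1 p q‖ := by
  have h := PiLp.norm_apply_le (layerVec a H δ 1 p q) 1
  rwa [layerVec_apply_one, Real.norm_eq_abs] at h

/-- In-layer vectors: `‖layerVec a 0 0 1 p q‖² = a² (p² + p q + q²)`. [folklore] -/
theorem cake_norm_layerVec_inLayer_sq (a : ℝ) (p q : ℤ) :
    ‖layerVec a 0 0 1 p q‖ ^ 2 = a ^ 2 * ((p : ℝ) ^ 2 + p * q + q ^ 2) := by
  rw [norm_layerVec, Real.sq_sqrt (by positivity)]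
  have h3 : (√3 : ℝ) ^ 2 = 3 := Real.sq_sqrt (by norm_num)
  push_cast
  linear_combination (a ^ 2 * (q : ℝ) ^ 2 / 4) * h3

/-- **In-layer separation**: `a ≤ ‖layerVec a 0 0 1 p q‖` for `(p, q) ≠ 0`, `a ≥ 0`. [folklore] -/
theorem cake_le_norm_layerVec_inLayer (a : ℝ) (ha : 0 ≤ a) {p q : ℤ} (hpq : (p, q) ≠ 0) :
    a ≤ ‖layerVec a 0 0 1 p q‖ := by
  have hform : (1 : ℝ) ≤ ((p ^ 2 + p * q + q ^ 2 : ℤ) : ℝ) := by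
    exact_mod_cast one_le_sq_add_mul_add_sq hpq
  have h2 : a ^ 2 ≤ ‖layerVec a 0 0 1 p q‖ ^ 2 := by
    rw [cake_norm_layerVec_inLayer_sq]
    push_cast at hform
    nlinarith [sq_nonneg a]
  exact (pow_le_pow_iff_left₀ ha (norm_nonneg _) two_ne_zero).1 h2

/-! ## Heights -/

/-- Heights with increments `≥ 39a/50` grow at least linearly: `(39a/50) (m' - m) ≤ z m' - z m` for `m ≤ m'`.
[folklore] -/
theorem cake_height_diff_ge (a : ℝ) (z : ℤ → ℝ) (hz : ∀ m : ℤ, 39 / 50 * a ≤ z (m + 1) - z m) (m : ℤ) (k : ℕ) :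
    39 / 50 * a * k ≤ z (m + k) - z m := by
  induction k with
  | zero => simp
  | succ k ih =>
    have := hz (m + k)
    push_cast
    rw [← add_assoc]
    linarith

/-- `|z m' - z m| ≥ (39a/50) |m' - m|` for heights in the box (`a ≥ 0`). [folklore] -/
theorem cake_abs_height_diff_ge (a : ℝ) (ha : 0 ≤ a) (z : ℤ → ℝ)
    (hz : ∀ m : ℤ, 39 / 50 * a ≤ z (m + 1) - z m) (m m' : ℤ) :
    39 / 50 * a * |((m' : ℝ) - m)| ≤ |z m' - z m| := by
  rcases le_total m m' with h | h
  · obtain ⟨k, rfl⟩ := Int.exists_add_of_le h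
    have := cake_height_diff_ge a z hz m k
    have h0 : (0 : ℝ) ≤ 39 / 50 * a * k := by positivity
    push_cast
    rw [add_sub_cancel_left, Nat.abs_cast, abs_of_nonneg (h0.trans this)]
    exact this
  · obtain ⟨k, rfl⟩ := Int.exists_add_of_le h
    have := cake_height_diff_ge a z hz m' k
    have h0 : (0 : ℝ) ≤ 39 / 50 * a * k := by positivity
    push_cast
    rw [show (m' : ℝ) - (m' + k) = -k by ring, abs_neg, Nat.abs_cast, abs_sub_comm,
      abs_of_nonneg (h0.trans this)]
    exact this

/-- Heights in the box are strictly increasing, hence injective. [folklore] -/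
theorem cake_height_injective (a : ℝ) (ha : 0 < a) (z : ℤ → ℝ)
    (hz : ∀ m : ℤ, 39 / 50 * a ≤ z (m + 1) - z m) : Function.Injective z := by
  have hmono : StrictMono z := strictMono_int_of_lt_succ fun m => by have := hz m; linarith
  exact hmono.injective

/-- Distinct layers are vertically `≥ 7/10` apart (`a ≥ 47/50`). [folklore] -/
theorem cake_height_sep (a : ℝ) (ha : 47 / 50 ≤ a) (z : ℤ → ℝ)
    (hz : ∀ m : ℤ, 39 / 50 * a ≤ z (m + 1) - z m) {m m' : ℤ} (hne : m' ≠ m) :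
    7 / 10 ≤ |z m' - z m| := by
  have h1 := cake_abs_height_diff_ge a (by linarith) z hz m m'
  have h2 : (1 : ℝ) ≤ |((m' : ℝ) - m)| := by
    rw [← Int.cast_sub, ← Int.cast_abs]
    exact_mod_cast Int.one_le_abs (sub_ne_zero.2 hne)
  nlinarith

/-! ## Injectivity of the parametrisation and separation -/

/-- The parametrisation `(m, i, j) ↦ layerVec a (z m) (L m) 1 i j` is injective when `a ≠ 0` and the heights are
injective. [folklore] -/
theorem cake_param_injective (a : ℝ) (ha : a ≠ 0) (L : ℤ → ℤ) (z : ℤ → ℝ) (hz : Function.Injective z)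
    {m i j m' i' j' : ℤ} (h : layerVec a (z m) (L m) 1 i j = layerVec a (z m') (L m') 1 i' j') :
    m = m' ∧ i = i' ∧ j = j' := by
  have e2 := congrArg (fun v : E3 => v 2) h
  have e1 := congrArg (fun v : E3 => v 1) h
  have e0 := congrArg (fun v : E3 => v 0) h
  simp only [cake_layerVec_apply_two] at e2
  obtain rfl : m = m' := hz e2
  simp only [layerVec_apply_one, layerVec_apply_zero] at e0 e1
  have h3 : (0 : ℝ) < √3 := by positivity
  have hj : (j : ℝ) = j' := by
    have := mul_left_cancel₀ (by positivity : a * √3 / 2 ≠ 0) e1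
    linarith
  have hi : (i : ℝ) = i' := by
    have := mul_left_cancel₀ ha e0
    linarith
  exact ⟨rfl, by exact_mod_cast hi, by exact_mod_cast hj⟩

/-- **`1/2`-separation of a layered set.** For `a ≥ 47/50`, any linear isometry `A`, any label walk `s` and heights
with increments `≥ 39a/50`, distinct points of `S(A, s, z)` are at distance `≥ 1/2` (same layer: `≥ a`; different
layers: vertical distance `≥ 39a/50`). [folklore] -/
theorem cake_separated (a : ℝ) (ha : 47 / 50 ≤ a) (A : E3 →ₗᵢ[ℝ] E3) (s : ℤ → ℤ) (z : ℤ → ℝ)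
    (hz : ∀ m : ℤ, 39 / 50 * a ≤ z (m + 1) - z m) :
    ∀ p ∈ {p : E3 | ∃ m i j : ℤ, p = A (((i : ℝ) • triangularVec₁ a) + ((j : ℝ) • triangularVec₂ a) +
        ((haggLabel s m : ℝ) • barlowOffset a) + (z m • layerNormal 1))},
      ∀ q ∈ {p : E3 | ∃ m i j : ℤ, p = A (((i : ℝ) • triangularVec₁ a) + ((j : ℝ) • triangularVec₂ a) +
        ((haggLabel s m : ℝ) • barlowOffset a) + (z m • layerNormal 1))},
      p ≠ q → 1 / 2 ≤ dist p q := by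
  rintro p ⟨m, i, j, rfl⟩ q ⟨m', i', j', rfl⟩ hne
  rw [cake_pt_eq_layerVec, cake_pt_eq_layerVec] at hne ⊢
  rw [LinearIsometry.dist_map, dist_comm, dist_eq_norm, cake_layerVec_sub]
  by_cases hm : m' = m
  · subst hm
    have hij : (i' - i, j' - j) ≠ 0 := by
      intro h0
      simp only [Prod.mk_eq_zero, sub_eq_zero] at h0
      obtain ⟨rfl, rfl⟩ := h0
      exact hne rfl
    rw [sub_self, sub_self]
    have := cake_le_norm_layerVec_inLayer a (by linarith) hij
    linarith
  · have h1 := cake_abs_height_le_norm a (z m' - z m) (haggLabel s m' - haggLabel s m) (i' - i) (j' - j)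
    have h2 := cake_height_sep a ha z hz hm
    linarith

end Summit.AtomisticToContinuum.Crystallization.Theorems.LayeredHull
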